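/-
Copyright (c) 2026 the pub-hodgecm-mathlib formalisation cell (harness21).  Prover seat hodgecm-mathlib-K2E1-p13 (g0), Track B ∕ K2-LIT, h413 =
`stmt-HodgeConjecture-24833`, line `K2_E1_TraceFormulaBeta`, campaign «EIS-R7-BL-SPH-3» ∕ R8-LADDER-3, «MS-3» (σ1)₃+(σ2)₃ — the OPERATOR-ROAD socket at `N = 3` (dealer K2E1-plan (g6)
DEAL (71) 2026-09-04T10:25:29Z; ruling (55) «the OPERATOR ROAD … L²-holomorphy = CLM ∘ holomorphic vX, no a.e. bookkeeping»): [MW] IV.3.12 (a) at `N = 3` from ONE analytic input — an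
`L²(X)`-holomorphic extension `F` of the truncated spherical Eisenstein classes of `U(2,1)∕CM` from Godement's tube `{Re > 2}` to the quadrant `D± = {Re > 1, Im ≷ 0}`.
The `N = 3` twin of ★ p859344 `K2E1MaassSelbergPairingFamilyCMTwo` (K2E4-p11 (g5)).
-/
import Summits.HodgeConjecture.HodgeConjecture.Theorems.K2E1MaassSelbergPairingContinuedCMThree   -- ★ p859322 (this seat): `exists_fourTerm_tube_cm_three` ((R6k)₃ ∘ ★ p859287 §C₃ free decay); brings ★ p859225 §A `pairing_of_differentiableOn`, ★ p859140 (both quadrants)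
import HarnessLib

/-!
# h413 ∕ Track B «K2-LIT», «MS-3» — `K2E1MaassSelbergPairingFamilyCMThree`: pole control of the continued intertwining scalar of `U(2,1)∕CM` on `D± = {Re z > 1, Im z ≷ 0}` from ONE
# analytic input — an `L²(X,μ)`-valued HOLOMORPHIC family `F` on `D±` with `F z = [Λ^T E(φ₀H^z)]` on the tube `Re z > 2` (the operator-road socket at `N = 3`)

Cell `pub/hodgecm-mathlib`, crux H413 = `stmt-HodgeConjecture-24833`, route `HCCMUnconditional`; dealer K2E1-plan (g6) (71).  THEOREMS ONLY (no `def`, no `instance`, no `notation`, no `sorry`;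
default heartbeats); lane `--kind proof --supports stmt-HodgeConjecture-24833 --as helper` (count-neutral).  WHY.  In ★ p859322 `poleControl_continued_cm_three_of_letters` the continued family
enters through pointwise∕a.e. letters (i′)(m′)(ii′); but ★ §A `pairing_of_differentiableOn` needs only an `L²`-HOLOMORPHIC `F`, and `hrel` needs `F z = [Λ^TE(z)]` ONLY ON THE TUBE.  So the
minimal socket is: **`F : ℂ → L²(X,μ)` complex differentiable on `D⁺` (resp. `D⁻`) with `F z = [quotFun Λ^T E(φ₀H^z)]` a.e. for `z ∈ D± ∩ {Re > 2}`** — payable WITHOUT pointwise majorants by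
the operator road (`F z = A_T(ι(vX z)) + ĥ_i(z)⁻¹ • K_T(vX z)`, `A_T`, `K_T` continuous linear, `vX` the holomorphic `HX`-valued B–L solution at `N = 3`), or by ★ p859322 §1
`exists_toLp_differentiableOn_of_local_weighted_bound`.  Given `F`: `hΦ₁ hΦ₂ hQ` are ★ §A, `hrel` is ★ `exists_fourTerm_tube_cm_three` through the a.e. representation on the tube, and ★
p859140 `poleControl_continued_cm_three_of_pairing[_lower]` conclude.
* HEADS **`poleControl_continued_cm_three_of_family (F) (hFd) (hFtube) …`** (`D⁺`) and **`poleControl_continued_cm_three_of_family_lower`** (`D⁻`): (a1)∧(a2)∧(a3) of ★ p859140 for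
  the continued scalar `c` (`hc : DifferentiableOn ℂ c D±`, `hceq` on the tube `{Re > 2}`), `a = κ_ℝ·m·|φ₀|²`, `b = κ_ℝ·m·|c z|²|φ₀|²`, `x = Re z − 1`.
HONEST LABEL.  Count-neutral helper; proves no printed statement; conditional on `F`, `hc`, `hceq`; HC_CM is proved only modulo the 7 printed citations (2 remaining named inputs: hLiu418 =
`stmt-HodgeConjecture-24832`, h413 = `stmt-HodgeConjecture-24833`) until rung 0 closes.

## References
* [MoeglinWaldspurger1995] C. Mœglin, J.-L. Waldspurger, *Spectral decomposition and Eisenstein series* (1995), IV.2.3, IV.3.12 (a).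
* [BernsteinLapid2019] J. Bernstein, E. Lapid, *On the meromorphic continuation of Eisenstein series*, J. AMS 37 (2024), §4 (Claims 4–5).
* [Arthur1980TraceFormulaII] J. Arthur, *A trace formula for reductive groups II*, Compositio Math. 40 (1980), §4.
-/

set_option autoImplicit false
set_option linter.dupNamespace false  -- the mandated namespace repeats the summit's segment (`HodgeConjecture.HodgeConjecture`)

noncomputable section

open MeasureTheory Measure NumberField IsDedekindDomain Set Filter Topology Metric MulAction
open scoped ENNReal NNReal ComplexConjugate InnerProductSpace
open Literature.MeasureTheory.Group Literature.NumberTheory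
open Literature.NumberTheory.Automorphic Literature.NumberTheory.Automorphic.UnitaryGroup AdelicGroupData
open Summit.HodgeConjecture.HodgeConjecture.Cruxes.H413.K2E1BorelEisensteinU
open Summit.HodgeConjecture.HodgeConjecture.Cruxes.H413.K2E1MaassSelbergPairingCMTwo (pairing_of_differentiableOn)
open Summit.HodgeConjecture.HodgeConjecture.Cruxes.H413.K2E1MaassSelbergPairingContinuedCMThree (exists_fourTerm_tube_cm_three)
open Summit.HodgeConjecture.HodgeConjecture.Cruxes.H413.K2E1MaassSelbergContinuedCMThree (poleControl_continued_cm_three_of_pairing poleControl_continued_cm_three_of_pairing_lower)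
open Summit.HodgeConjecture.HodgeConjecture.Cruxes.H413.K2E1MaassSelbergSphericalBracketsCMThree (measureReal_maximalCompact_pos idelicBracket_pos)

namespace Summit.HodgeConjecture.HodgeConjecture.Cruxes.H413.K2E1MaassSelbergPairingFamilyCMThree

variable (L : Type) [Field L] [NumberField L] [IsCMField L]
variable [MeasurableSpace (quasiSplit (↥(maximalRealSubfield L)) L (IsCMField.complexConj L) 3).Adelic] [BorelSpace (quasiSplit (↥(maximalRealSubfield L)) L (IsCMField.complexConj L) 3).Adelic]
variable [MeasurableSpace (AdeleRing (𝓞 L) L)ˣ] [BorelSpace (AdeleRing (𝓞 L) L)ˣ]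

/-- **[MW] IV.3.12 (a) AT `N = 3` ON `D⁺ = {Re > 1, Im > 0}` FROM AN `L²`-HOLOMORPHIC EXTENSION OF THE TRUNCATED EISENSTEIN CLASSES.**  Structural data of ★ (R6k)₃; `φ₀ ≠ 0`; the continued
scalar `c` holomorphic on `D⁺` with (hceq) on the tube `{Re > 2}`; and ONE analytic input: `F : ℂ → L²(X,μ)` complex differentiable on `D⁺` with `F z = [Λ^T E(φ₀H^z)]` a.e. for `z ∈ D⁺`,
`Re z > 2`.  THEN at every `z ∈ D⁺` (a1)∧(a2)∧(a3) of ★ `poleControl_continued_cm_three_of_pairing` for `c` (`a = κ_ℝ·m·|φ₀|²`, `b = κ_ℝ·m·|c z|²|φ₀|²`, `x = Re z − 1`, `y = Im z`).  Proof: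
★ §A on `D⁺` (`conj⁻¹D⁺ = D⁻`), `hrel` = the a.e. representation on the tube ∘ ★ `exists_fourTerm_tube_cm_three`, then ★ p859140. [cite: MoeglinWaldspurger1995, IV.3.12 (a)] [cite: BernsteinLapid2019, §4] [cite: Arthur1980TraceFormulaII, §4] -/
theorem poleControl_continued_cm_three_of_family
    (μ : Measure (quasiSplit (↥(maximalRealSubfield L)) L (IsCMField.complexConj L) 3).automorphicQuotient) [(quasiSplit (↥(maximalRealSubfield L)) L (IsCMField.complexConj L) 3).IsAutomorphicMeasure μ]
    (νG : Measure (quasiSplit (↥(maximalRealSubfield L)) L (IsCMField.complexConj L) 3).Adelic) [νG.IsHaarMeasure] [νG.IsInvInvariant]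
    (μK : Measure ((standardMaximalCompactGL 3 L).comap (adelicVal (↥(maximalRealSubfield L)) L (IsCMField.complexConj L) 3 ((StdForm.antidiagonal 3).over L)) : Subgroup (quasiSplit (↥(maximalRealSubfield L)) L (IsCMField.complexConj L) 3).Adelic))
    [μK.IsHaarMeasure]
    (νI : Measure (AdeleRing (𝓞 L) L)ˣ) [νI.IsHaarMeasure]
    {𝓕I : Set (AdeleRing (𝓞 L) L)ˣ} (h𝓕I : IsIdeleClassDomain L 𝓕I)
    (ν : Measure ↥(adelicUnipotent (↥(maximalRealSubfield L)) L (IsCMField.complexConj L) 3)) [ν.IsHaarMeasure]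
    {𝓕 : Set ↥(adelicUnipotent (↥(maximalRealSubfield L)) L (IsCMField.complexConj L) 3)} (h𝓕N : IsFundamentalDomain ↥(rationalUnipotent (↥(maximalRealSubfield L)) L (IsCMField.complexConj L) 3) 𝓕 ν) (h𝓕1 : ν 𝓕 = 1)
    (h𝓕c : IsCompact (closure 𝓕))
    {T : ℝ≥0} (hT : 1 ≤ T) {φ₀ : ℂ} (hφ₀ : φ₀ ≠ 0)
    {β : (quasiSplit (↥(maximalRealSubfield L)) L (IsCMField.complexConj L) 3).Adelic → ℝ≥0∞} (hβ : IsCoveringWeight ((arithmeticBorel (↥(maximalRealSubfield L)) L (IsCMField.complexConj L) 3).map (quasiSplit (↥(maximalRealSubfield L)) L (IsCMField.complexConj L) 3).arithmeticSubgroup.subtype) β)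
    {c : ℂ → ℂ} (hc : DifferentiableOn ℂ c {z : ℂ | 1 < z.re ∧ 0 < z.im}) (hceq : ∀ z : ℂ, 2 < z.re → c z = (∫ v : ↥(adelicUnipotent (↥(maximalRealSubfield L)) L (IsCMField.complexConj L) 3), (((borelHeight ((quasiSplit (↥(maximalRealSubfield L)) L (IsCMField.complexConj L) 3).toAdelic (weylLongU ((IsCMField.complexConj L : L ≃ₐ[↥(maximalRealSubfield L)] L) : L →+* L) (rfl : (StdForm.antidiagonal 3).over L = (StdForm.antidiagonal 3).over L)) * (v : (quasiSplit (↥(maximalRealSubfield L)) L (IsCMField.complexConj L) 3).Adelic))) : ℝ) : ℂ) ^ z ∂ν))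
    (F : ℂ → Lp ℂ 2 μ) (hFd : DifferentiableOn ℂ F {z : ℂ | 1 < z.re ∧ 0 < z.im})
    (hFtube : ∀ z ∈ {z : ℂ | 1 < z.re ∧ 0 < z.im}, 2 < z.re → ((F z : Lp ℂ 2 μ) : (quasiSplit (↥(maximalRealSubfield L)) L (IsCMField.complexConj L) 3).automorphicQuotient → ℂ) =ᵐ[μ] (quasiSplit (↥(maximalRealSubfield L)) L (IsCMField.complexConj L) 3).quotFun (truncation ν 𝓕 T (eisensteinSeriesU (flatSectionU (fun _ : (quasiSplit (↥(maximalRealSubfield L)) L (IsCMField.complexConj L) 3).Adelic => φ₀) z))))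
    {z : ℂ} (hz : z ∈ {z : ℂ | 1 < z.re ∧ 0 < z.im}) :
    Real.sqrt ((∫ x in {x : (AdeleRing (𝓞 L) L)ˣ | (IdeleClassGroup.ideleNorm L x : ℝ) ≤ 1} ∩ 𝓕I, (IdeleClassGroup.ideleNorm L x : ℝ) ∂νI) * μK.real Set.univ * ‖c z‖ ^ 2 * ‖φ₀‖ ^ 2) ≤ (z.re - 1) * (T : ℝ) ^ (2 * (z.re - 1)) * Real.sqrt ((∫ x in {x : (AdeleRing (𝓞 L) L)ˣ | (IdeleClassGroup.ideleNorm L x : ℝ) ≤ 1} ∩ 𝓕I, (IdeleClassGroup.ideleNorm L x : ℝ) ∂νI) * μK.real Set.univ * ‖φ₀‖ ^ 2) / |z.im| +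
        Real.sqrt ((z.re - 1) ^ 2 * (T : ℝ) ^ (4 * (z.re - 1)) * ((∫ x in {x : (AdeleRing (𝓞 L) L)ˣ | (IdeleClassGroup.ideleNorm L x : ℝ) ≤ 1} ∩ 𝓕I, (IdeleClassGroup.ideleNorm L x : ℝ) ∂νI) * μK.real Set.univ * ‖φ₀‖ ^ 2) / z.im ^ 2 + ((∫ x in {x : (AdeleRing (𝓞 L) L)ˣ | (IdeleClassGroup.ideleNorm L x : ℝ) ≤ 1} ∩ 𝓕I, (IdeleClassGroup.ideleNorm L x : ℝ) ∂νI) * μK.real Set.univ * ‖φ₀‖ ^ 2) * (T : ℝ) ^ (4 * (z.re - 1))) ∧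
      (∀ {x₁ x₂ η : ℝ}, 0 < x₁ → (z.re - 1) ∈ Set.Icc x₁ x₂ → 0 < η → η ≤ |z.im| →
        (∫ x in {x : (AdeleRing (𝓞 L) L)ˣ | (IdeleClassGroup.ideleNorm L x : ℝ) ≤ 1} ∩ 𝓕I, (IdeleClassGroup.ideleNorm L x : ℝ) ∂νI) * μK.real Set.univ * ‖c z‖ ^ 2 * ‖φ₀‖ ^ 2 ≤ (x₂ * (T : ℝ) ^ (2 * x₂) * Real.sqrt ((∫ x in {x : (AdeleRing (𝓞 L) L)ˣ | (IdeleClassGroup.ideleNorm L x : ℝ) ≤ 1} ∩ 𝓕I, (IdeleClassGroup.ideleNorm L x : ℝ) ∂νI) * μK.real Set.univ * ‖φ₀‖ ^ 2) / η + Real.sqrt (x₂ ^ 2 * (T : ℝ) ^ (4 * x₂) * ((∫ x in {x : (AdeleRing (𝓞 L) L)ˣ | (IdeleClassGroup.ideleNorm L x : ℝ) ≤ 1} ∩ 𝓕I, (IdeleClassGroup.ideleNorm L x : ℝ) ∂νI) * μK.real Set.univ * ‖φ₀‖ ^ 2) / η ^ 2 + ((∫ x in {x : (AdeleRing (𝓞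 L) L)ˣ | (IdeleClassGroup.ideleNorm L x : ℝ) ≤ 1} ∩ 𝓕I, (IdeleClassGroup.ideleNorm L x : ℝ) ∂νI) * μK.real Set.univ * ‖φ₀‖ ^ 2) * (T : ℝ) ^ (4 * x₂))) ^ 2) ∧
      (|z.im| ≤ 1 → (∫ x in {x : (AdeleRing (𝓞 L) L)ˣ | (IdeleClassGroup.ideleNorm L x : ℝ) ≤ 1} ∩ 𝓕I, (IdeleClassGroup.ideleNorm L x : ℝ) ∂νI) * μK.real Set.univ * ‖c z‖ ^ 2 * ‖φ₀‖ ^ 2 ≤ ((z.re - 1) * (T : ℝ) ^ (2 * (z.re - 1)) * Real.sqrt ((∫ x in {x : (AdeleRing (𝓞 L) L)ˣ | (IdeleClassGroup.ideleNorm L x : ℝ) ≤ 1} ∩ 𝓕I, (IdeleClassGroup.ideleNorm L x : ℝ) ∂νI) * μK.real Set.univ * ‖φ₀‖ ^ 2) +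
        Real.sqrt ((z.re - 1) ^ 2 * (T : ℝ) ^ (4 * (z.re - 1)) * ((∫ x in {x : (AdeleRing (𝓞 L) L)ˣ | (IdeleClassGroup.ideleNorm L x : ℝ) ≤ 1} ∩ 𝓕I, (IdeleClassGroup.ideleNorm L x : ℝ) ∂νI) * μK.real Set.univ * ‖φ₀‖ ^ 2) + ((∫ x in {x : (AdeleRing (𝓞 L) L)ˣ | (IdeleClassGroup.ideleNorm L x : ℝ) ≤ 1} ∩ 𝓕I, (IdeleClassGroup.ideleNorm L x : ℝ) ∂νI) * μK.real Set.univ * ‖φ₀‖ ^ 2) * (T : ℝ) ^ (4 * (z.re - 1)))) ^ 2 / z.im ^ 2)  := by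
  have hDo : IsOpen {z : ℂ | 1 < z.re ∧ 0 < z.im} := (isOpen_lt continuous_const Complex.continuous_re).inter (isOpen_lt continuous_const Complex.continuous_im)
  obtain ⟨hΦ₁, hΦ₂, hQ⟩ := pairing_of_differentiableOn hDo hFd
  have hraw : ∀ z ∈ {z : ℂ | 1 < z.re ∧ 0 < z.im}, ∀ z' ∈ {z : ℂ | 1 < z.re ∧ 0 < z.im}, 2 < z.re → 2 < z'.re →
      ⟪F z', F z⟫_ℂ = ∫ x, (quasiSplit (↥(maximalRealSubfield L)) L (IsCMField.complexConj L) 3).quotFun (truncation ν 𝓕 T (eisensteinSeriesU (flatSectionU (fun _ : (quasiSplit (↥(maximalRealSubfield L)) L (IsCMField.complexConj L) 3).Adelic => φ₀) z))) x * conj ((quasiSplit (↥(maximalRealSubfield L)) L (IsCMField.complexConj L) 3).quotFun (truncation ν 𝓕 T (eisensteinSeriesU (flatSectionU (fun _ : (quasiSplit (↥(maximalRealSubfield L)) L (IsCMField.complexConj L) 3).Adelic => φ₀) z'))) x) ∂μ := by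
    intro z hz z' hz' hz1 hz'1
    rw [MeasureTheory.L2.inner_def]
    refine integral_congr_ae ?_
    filter_upwards [hFtube z hz hz1, hFtube z' hz' hz'1] with x hx hx'
    rw [hx, hx', RCLike.inner_apply, mul_comm]
  obtain ⟨cμ, K, hcμ, hK, h4⟩ := exists_fourTerm_tube_cm_three L μ νG μK νI h𝓕I ν h𝓕N h𝓕1 h𝓕c T hT φ₀ hβ c hceq
  have hκr : 0 < (∫ x in {x : (AdeleRing (𝓞 L) L)ˣ | (IdeleClassGroup.ideleNorm L x : ℝ) ≤ 1} ∩ 𝓕I, (IdeleClassGroup.ideleNorm L x : ℝ) ∂νI) := idelicBracket_pos νI h𝓕I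
  have hmK : 0 < μK.real Set.univ := measureReal_maximalCompact_pos μK
  have hconj : {w : ℂ | conj w ∈ {z : ℂ | 1 < z.re ∧ 0 < z.im}} = {w : ℂ | 1 < w.re ∧ w.im < 0} := by
    ext w; simp only [Set.mem_setOf_eq, Complex.conj_re, Complex.conj_im, Left.neg_pos_iff]
  have hΦ₂' : ∀ z ∈ {z : ℂ | 1 < z.re ∧ 0 < z.im}, DifferentiableOn ℂ (fun w : ℂ => ⟪F (conj w), F z⟫_ℂ) {w : ℂ | 1 < w.re ∧ w.im < 0} := fun z hz => hconj ▸ hΦ₂ z hz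
  have hrel : ∀ z ∈ {z : ℂ | 1 < z.re ∧ 0 < z.im}, ∀ z' ∈ {z : ℂ | 1 < z.re ∧ 0 < z.im}, 2 < z'.re → z'.re < z.re →
      ⟪F z', F z⟫_ℂ = ((cμ : ℝ) : ℂ) * (((K : ℝ) : ℂ) *
        ((((T : ℝ) : ℂ) ^ (z + conj z' - 2) / (z + conj z' - 2)) * ((((∫ x in {x : (AdeleRing (𝓞 L) L)ˣ | (IdeleClassGroup.ideleNorm L x : ℝ) ≤ 1} ∩ 𝓕I, (IdeleClassGroup.ideleNorm L x : ℝ) ∂νI) : ℝ) : ℂ) * (((μK.real Set.univ : ℝ) : ℂ) * (φ₀ * conj φ₀)))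
          + (((T : ℝ) : ℂ) ^ (z - conj z') / (z - conj z')) * ((((∫ x in {x : (AdeleRing (𝓞 L) L)ˣ | (IdeleClassGroup.ideleNorm L x : ℝ) ≤ 1} ∩ 𝓕I, (IdeleClassGroup.ideleNorm L x : ℝ) ∂νI) : ℝ) : ℂ) * (((μK.real Set.univ : ℝ) : ℂ) * (φ₀ * conj (c z' * φ₀))))
          - (((T : ℝ) : ℂ) ^ (-(z - conj z')) / (z - conj z')) * ((((∫ x in {x : (AdeleRing (𝓞 L) L)ˣ | (IdeleClassGroup.ideleNorm L x : ℝ) ≤ 1} ∩ 𝓕I, (IdeleClassGroup.ideleNorm L x : ℝ) ∂νI) : ℝ) : ℂ) * (((μK.real Set.univ : ℝ) : ℂ) * (c z * φ₀ * conj φ₀)))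
          - (((T : ℝ) : ℂ) ^ (-(z + conj z' - 2)) / (z + conj z' - 2)) * ((((∫ x in {x : (AdeleRing (𝓞 L) L)ˣ | (IdeleClassGroup.ideleNorm L x : ℝ) ≤ 1} ∩ 𝓕I, (IdeleClassGroup.ideleNorm L x : ℝ) ∂νI) : ℝ) : ℂ) * (((μK.real Set.univ : ℝ) : ℂ) * (c z * φ₀ * conj (c z' * φ₀)))))) := by
    intro z hz z' hz' h1 h2
    rw [hraw z hz z' hz' (h1.trans h2) h1]
    exact h4 z z' h1 h2
  exact poleControl_continued_cm_three_of_pairing (T := (T : ℝ)) (by exact_mod_cast hT) hcμ hK hκr hmK hφ₀ hc (Φ := fun z z' => ⟪F z', F z⟫_ℂ) hΦ₁ hΦ₂' hrel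
    (Q := fun z => ‖F z‖ ^ 2) hQ hz


/-- **THE LOWER QUADRANT `D⁻ = {Re > 1, Im < 0}` (`N = 3`)**: the same from an `L²`-holomorphic extension to `D⁻`, through ★ p859140 `poleControl_continued_cm_three_of_pairing_lower`. [cite: MoeglinWaldspurger1995, IV.3.12 (a)] [cite: BernsteinLapid2019, §4] -/
theorem poleControl_continued_cm_three_of_family_lower
    (μ : Measure (quasiSplit (↥(maximalRealSubfield L)) L (IsCMField.complexConj L) 3).automorphicQuotient) [(quasiSplit (↥(maximalRealSubfield L)) L (IsCMField.complexConj L) 3).IsAutomorphicMeasure μ]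
    (νG : Measure (quasiSplit (↥(maximalRealSubfield L)) L (IsCMField.complexConj L) 3).Adelic) [νG.IsHaarMeasure] [νG.IsInvInvariant]
    (μK : Measure ((standardMaximalCompactGL 3 L).comap (adelicVal (↥(maximalRealSubfield L)) L (IsCMField.complexConj L) 3 ((StdForm.antidiagonal 3).over L)) : Subgroup (quasiSplit (↥(maximalRealSubfield L)) L (IsCMField.complexConj L) 3).Adelic))
    [μK.IsHaarMeasure]
    (νI : Measure (AdeleRing (𝓞 L) L)ˣ) [νI.IsHaarMeasure]
    {𝓕I : Set (AdeleRing (𝓞 L) L)ˣ} (h𝓕I : IsIdeleClassDomain L 𝓕I)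
    (ν : Measure ↥(adelicUnipotent (↥(maximalRealSubfield L)) L (IsCMField.complexConj L) 3)) [ν.IsHaarMeasure]
    {𝓕 : Set ↥(adelicUnipotent (↥(maximalRealSubfield L)) L (IsCMField.complexConj L) 3)} (h𝓕N : IsFundamentalDomain ↥(rationalUnipotent (↥(maximalRealSubfield L)) L (IsCMField.complexConj L) 3) 𝓕 ν) (h𝓕1 : ν 𝓕 = 1)
    (h𝓕c : IsCompact (closure 𝓕))
    {T : ℝ≥0} (hT : 1 ≤ T) {φ₀ : ℂ} (hφ₀ : φ₀ ≠ 0)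
    {β : (quasiSplit (↥(maximalRealSubfield L)) L (IsCMField.complexConj L) 3).Adelic → ℝ≥0∞} (hβ : IsCoveringWeight ((arithmeticBorel (↥(maximalRealSubfield L)) L (IsCMField.complexConj L) 3).map (quasiSplit (↥(maximalRealSubfield L)) L (IsCMField.complexConj L) 3).arithmeticSubgroup.subtype) β)
    {c : ℂ → ℂ} (hc : DifferentiableOn ℂ c {w : ℂ | 1 < w.re ∧ w.im < 0}) (hceq : ∀ z : ℂ, 2 < z.re → c z = (∫ v : ↥(adelicUnipotent (↥(maximalRealSubfield L)) L (IsCMField.complexConj L) 3), (((borelHeight ((quasiSplit (↥(maximalRealSubfield L)) L (IsCMField.complexConj L) 3).toAdelic (weylLongU ((IsCMField.complexConj L : L ≃ₐ[↥(maximalRealSubfield L)] L) : L →+* L) (rfl : (StdForm.antidiagonal 3).over L = (StdForm.antidiagonal 3).over L)) * (v : (quasiSplit (↥(maximalRealSubfield L)) L (IsCMField.complexConj L) 3).Adelic))) : ℝ) : ℂ) ^ z ∂ν))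
    (F : ℂ → Lp ℂ 2 μ) (hFd : DifferentiableOn ℂ F {w : ℂ | 1 < w.re ∧ w.im < 0})
    (hFtube : ∀ z ∈ {w : ℂ | 1 < w.re ∧ w.im < 0}, 2 < z.re → ((F z : Lp ℂ 2 μ) : (quasiSplit (↥(maximalRealSubfield L)) L (IsCMField.complexConj L) 3).automorphicQuotient → ℂ) =ᵐ[μ] (quasiSplit (↥(maximalRealSubfield L)) L (IsCMField.complexConj L) 3).quotFun (truncation ν 𝓕 T (eisensteinSeriesU (flatSectionU (fun _ : (quasiSplit (↥(maximalRealSubfield L)) L (IsCMField.complexConj L) 3).Adelic => φ₀) z))))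
    {z : ℂ} (hz : z ∈ {w : ℂ | 1 < w.re ∧ w.im < 0}) :
    Real.sqrt ((∫ x in {x : (AdeleRing (𝓞 L) L)ˣ | (IdeleClassGroup.ideleNorm L x : ℝ) ≤ 1} ∩ 𝓕I, (IdeleClassGroup.ideleNorm L x : ℝ) ∂νI) * μK.real Set.univ * ‖c z‖ ^ 2 * ‖φ₀‖ ^ 2) ≤ (z.re - 1) * (T : ℝ) ^ (2 * (z.re - 1)) * Real.sqrt ((∫ x in {x : (AdeleRing (𝓞 L) L)ˣ | (IdeleClassGroup.ideleNorm L x : ℝ) ≤ 1} ∩ 𝓕I, (IdeleClassGroup.ideleNorm L x : ℝ) ∂νI) * μK.real Set.univ * ‖φ₀‖ ^ 2) / |z.im| +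
        Real.sqrt ((z.re - 1) ^ 2 * (T : ℝ) ^ (4 * (z.re - 1)) * ((∫ x in {x : (AdeleRing (𝓞 L) L)ˣ | (IdeleClassGroup.ideleNorm L x : ℝ) ≤ 1} ∩ 𝓕I, (IdeleClassGroup.ideleNorm L x : ℝ) ∂νI) * μK.real Set.univ * ‖φ₀‖ ^ 2) / z.im ^ 2 + ((∫ x in {x : (AdeleRing (𝓞 L) L)ˣ | (IdeleClassGroup.ideleNorm L x : ℝ) ≤ 1} ∩ 𝓕I, (IdeleClassGroup.ideleNorm L x : ℝ) ∂νI) * μK.real Set.univ * ‖φ₀‖ ^ 2) * (T : ℝ) ^ (4 * (z.re - 1))) ∧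
      (∀ {x₁ x₂ η : ℝ}, 0 < x₁ → (z.re - 1) ∈ Set.Icc x₁ x₂ → 0 < η → η ≤ |z.im| →
        (∫ x in {x : (AdeleRing (𝓞 L) L)ˣ | (IdeleClassGroup.ideleNorm L x : ℝ) ≤ 1} ∩ 𝓕I, (IdeleClassGroup.ideleNorm L x : ℝ) ∂νI) * μK.real Set.univ * ‖c z‖ ^ 2 * ‖φ₀‖ ^ 2 ≤ (x₂ * (T : ℝ) ^ (2 * x₂) * Real.sqrt ((∫ x in {x : (AdeleRing (𝓞 L) L)ˣ | (IdeleClassGroup.ideleNorm L x : ℝ) ≤ 1} ∩ 𝓕I, (IdeleClassGroup.ideleNorm L x : ℝ) ∂νI) * μK.real Set.univ * ‖φ₀‖ ^ 2) / η + Real.sqrt (x₂ ^ 2 * (T : ℝ) ^ (4 * x₂) * ((∫ x in {x : (AdeleRing (𝓞 L) L)ˣ | (IdeleClassGroup.ideleNorm L x : ℝ) ≤ 1} ∩ 𝓕I, (IdeleClassGroup.ideleNorm L x : ℝ) ∂νI) * μK.real Set.univ * ‖φ₀‖ ^ 2) / η ^ 2 + ((∫ x in {x : (AdeleRing (𝓞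 L) L)ˣ | (IdeleClassGroup.ideleNorm L x : ℝ) ≤ 1} ∩ 𝓕I, (IdeleClassGroup.ideleNorm L x : ℝ) ∂νI) * μK.real Set.univ * ‖φ₀‖ ^ 2) * (T : ℝ) ^ (4 * x₂))) ^ 2) ∧
      (|z.im| ≤ 1 → (∫ x in {x : (AdeleRing (𝓞 L) L)ˣ | (IdeleClassGroup.ideleNorm L x : ℝ) ≤ 1} ∩ 𝓕I, (IdeleClassGroup.ideleNorm L x : ℝ) ∂νI) * μK.real Set.univ * ‖c z‖ ^ 2 * ‖φ₀‖ ^ 2 ≤ ((z.re - 1) * (T : ℝ) ^ (2 * (z.re - 1)) * Real.sqrt ((∫ x in {x : (AdeleRing (𝓞 L) L)ˣ | (IdeleClassGroup.ideleNorm L x : ℝ) ≤ 1} ∩ 𝓕I, (IdeleClassGroup.ideleNorm L x : ℝ) ∂νI) * μK.real Set.univ * ‖φ₀‖ ^ 2) +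
        Real.sqrt ((z.re - 1) ^ 2 * (T : ℝ) ^ (4 * (z.re - 1)) * ((∫ x in {x : (AdeleRing (𝓞 L) L)ˣ | (IdeleClassGroup.ideleNorm L x : ℝ) ≤ 1} ∩ 𝓕I, (IdeleClassGroup.ideleNorm L x : ℝ) ∂νI) * μK.real Set.univ * ‖φ₀‖ ^ 2) + ((∫ x in {x : (AdeleRing (𝓞 L) L)ˣ | (IdeleClassGroup.ideleNorm L x : ℝ) ≤ 1} ∩ 𝓕I, (IdeleClassGroup.ideleNorm L x : ℝ) ∂νI) * μK.real Set.univ * ‖φ₀‖ ^ 2) * (T : ℝ) ^ (4 * (z.re - 1)))) ^ 2 / z.im ^ 2)  := by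
  have hDo : IsOpen {w : ℂ | 1 < w.re ∧ w.im < 0} := (isOpen_lt continuous_const Complex.continuous_re).inter (isOpen_lt Complex.continuous_im continuous_const)
  obtain ⟨hΦ₁, hΦ₂, hQ⟩ := pairing_of_differentiableOn hDo hFd
  have hraw : ∀ z ∈ {w : ℂ | 1 < w.re ∧ w.im < 0}, ∀ z' ∈ {w : ℂ | 1 < w.re ∧ w.im < 0}, 2 < z.re → 2 < z'.re →
      ⟪F z', F z⟫_ℂ = ∫ x, (quasiSplit (↥(maximalRealSubfield L)) L (IsCMField.complexConj L) 3).quotFun (truncation ν 𝓕 T (eisensteinSeriesU (flatSectionU (fun _ : (quasiSplit (↥(maximalRealSubfield L)) L (IsCMField.complexConj L) 3).Adelic => φ₀) z))) x * conj ((quasiSplit (↥(maximalRealSubfield L)) L (IsCMField.complexConj L) 3).quotFun (truncation ν 𝓕 T (eisensteinSeriesU (flatSectionU (fun _ : (quasiSplit (↥(maximalRealSubfield L)) L (IsCMField.complexConj L) 3).Adelic => φ₀) z'))) x) ∂μ := by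
    intro z hz z' hz' hz1 hz'1
    rw [MeasureTheory.L2.inner_def]
    refine integral_congr_ae ?_
    filter_upwards [hFtube z hz hz1, hFtube z' hz' hz'1] with x hx hx'
    rw [hx, hx', RCLike.inner_apply, mul_comm]
  obtain ⟨cμ, K, hcμ, hK, h4⟩ := exists_fourTerm_tube_cm_three L μ νG μK νI h𝓕I ν h𝓕N h𝓕1 h𝓕c T hT φ₀ hβ c hceq
  have hκr : 0 < (∫ x in {x : (AdeleRing (𝓞 L) L)ˣ | (IdeleClassGroup.ideleNorm L x : ℝ) ≤ 1} ∩ 𝓕I, (IdeleClassGroup.ideleNorm L x : ℝ) ∂νI) := idelicBracket_pos νI h𝓕I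
  have hmK : 0 < μK.real Set.univ := measureReal_maximalCompact_pos μK
  have hconj : {w : ℂ | conj w ∈ {w : ℂ | 1 < w.re ∧ w.im < 0}} = {z : ℂ | 1 < z.re ∧ 0 < z.im} := by
    ext w; simp only [Set.mem_setOf_eq, Complex.conj_re, Complex.conj_im, Left.neg_neg_iff]
  have hΦ₂' : ∀ z ∈ {w : ℂ | 1 < w.re ∧ w.im < 0}, DifferentiableOn ℂ (fun w : ℂ => ⟪F (conj w), F z⟫_ℂ) {z : ℂ | 1 < z.re ∧ 0 < z.im} := fun z hz => hconj ▸ hΦ₂ z hz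
  have hrel : ∀ z ∈ {w : ℂ | 1 < w.re ∧ w.im < 0}, ∀ z' ∈ {w : ℂ | 1 < w.re ∧ w.im < 0}, 2 < z'.re → z'.re < z.re →
      ⟪F z', F z⟫_ℂ = ((cμ : ℝ) : ℂ) * (((K : ℝ) : ℂ) *
        ((((T : ℝ) : ℂ) ^ (z + conj z' - 2) / (z + conj z' - 2)) * ((((∫ x in {x : (AdeleRing (𝓞 L) L)ˣ | (IdeleClassGroup.ideleNorm L x : ℝ) ≤ 1} ∩ 𝓕I, (IdeleClassGroup.ideleNorm L x : ℝ) ∂νI) : ℝ) : ℂ) * (((μK.real Set.univ : ℝ) : ℂ) * (φ₀ * conj φ₀)))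
          + (((T : ℝ) : ℂ) ^ (z - conj z') / (z - conj z')) * ((((∫ x in {x : (AdeleRing (𝓞 L) L)ˣ | (IdeleClassGroup.ideleNorm L x : ℝ) ≤ 1} ∩ 𝓕I, (IdeleClassGroup.ideleNorm L x : ℝ) ∂νI) : ℝ) : ℂ) * (((μK.real Set.univ : ℝ) : ℂ) * (φ₀ * conj (c z' * φ₀))))
          - (((T : ℝ) : ℂ) ^ (-(z - conj z')) / (z - conj z')) * ((((∫ x in {x : (AdeleRing (𝓞 L) L)ˣ | (IdeleClassGroup.ideleNorm L x : ℝ) ≤ 1} ∩ 𝓕I, (IdeleClassGroup.ideleNorm L x : ℝ) ∂νI) : ℝ) : ℂ) * (((μK.real Set.univ : ℝ) : ℂ) * (c z * φ₀ * conj φ₀)))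
          - (((T : ℝ) : ℂ) ^ (-(z + conj z' - 2)) / (z + conj z' - 2)) * ((((∫ x in {x : (AdeleRing (𝓞 L) L)ˣ | (IdeleClassGroup.ideleNorm L x : ℝ) ≤ 1} ∩ 𝓕I, (IdeleClassGroup.ideleNorm L x : ℝ) ∂νI) : ℝ) : ℂ) * (((μK.real Set.univ : ℝ) : ℂ) * (c z * φ₀ * conj (c z' * φ₀)))))) := by
    intro z hz z' hz' h1 h2
    rw [hraw z hz z' hz' (h1.trans h2) h1]
    exact h4 z z' h1 h2
  exact poleControl_continued_cm_three_of_pairing_lower (T := (T : ℝ)) (by exact_mod_cast hT) hcμ hK hκr hmK hφ₀ hc (Φ := fun z z' => ⟪F z', F z⟫_ℂ) hΦ₁ hΦ₂' hrel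
    (Q := fun z => ‖F z‖ ^ 2) hQ hz


end Summit.HodgeConjecture.HodgeConjecture.Cruxes.H413.K2E1MaassSelbergPairingFamilyCMThree

end
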